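import Summits.BirchSwinnertonDyer.BirchSwinnertonDyer.Theorems.PrintX11aMuCosetDoor
import HarnessLib

/-!
# Route `PrintX11a` (cell `bsd-print-x11a`, seat p3): the Teichmüller-coset `μ`-door in the RECORDS' OWN
# coordinates — coset `{b : b^{p−1} = u^{p−1}}` of a displayed representative `u`
# (sequel of `PrintX11aMuCosetDoor.lean`; `--supports stmt-BirchSwinnertonDyer-20614 --as helper`)

ty3's `MuWitness` (schema `X11aPrintCertificates/Schema.lean`) displays a coset by a REPRESENTATIVE `u`
(`p ∤ u`) and its members `a` by `a^{p−1} ≡ u^{p−1} (mod pⁿ)` — this is what `Record.checkMu` decides.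
`X11a.muAnZeroAt_of_cosetTable` instead indexes the coset by the exponent `s₀` with `⟨u⟩ = (1+p)^{s₀}`
(a discrete logarithm the record does not carry). This file removes the gap: for odd `p` and a unit `u`
modulo `p^{n+1}` there is `s₀` with `u^{p−1} = (1+p)^{(p−1)s₀}` (`u = ξ·γ^{s₀}` for a Teichmüller `ξ`,
`MuCoset.exists_classMap_eq`, and `ξ^{p−1} = 1`), so **the door holds with the hypothesis
`b ∈ S ↔ b^{p−1} = u^{p−1}` verbatim** (`X11a.muAnZeroAt_of_cosetTable_of_unitRep`), and so do the
class-free rank-0 Euler-half doors (`X11a.missingUpperBoundAt_of_cosetTable_of_unitRep[_of_nonsplit]`).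
TURNKEY for ty2's record-level wrapper: `S := (w.symbols.map (·.1)).toFinset`, `u := w.u`, `hS` and the
unit sum from `Record.checkMu` through the `powModFast`/`invModFast` bridges. Theorems only; nothing
about any curve is asserted; the class-wide children U5/U3 stay open; beyond-print theorem: no.

References: [MazurTateTeitelbaum1986Invent] §I.10, §I.12–I.13; [Washington1997] §5.1, §7.2;
[Mazur1978] Cor. 4.1; HOME/TY3-CERTIFICATE-RECORDS.md §7 (the `mu` column), HOME/P3-EXCEPTIONAL-ZERO-ROAD.md §8.
-/

set_option autoImplicit false

noncomputable section

open scoped Classical MatrixGroups ModularForm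

open CongruenceSubgroup WeierstrassCurve Literature.NumberTheory.EllipticCurves
  Literature.NumberTheory.EllipticCurves.ModularForms
  Literature.NumberTheory.EllipticCurves.Rank1Residual
  Literature.NumberTheory.EllipticCurves.Rank1Residual.Typed
  Literature.NumberTheory.EllipticCurves.Wuthrich2014
  Literature.NumberTheory.EllipticCurves.SteinWuthrich2013
  Literature.NumberTheory.EllipticCurves.Greenberg1999
  Literature.NumberTheory.EllipticCurves.Kato2004

namespace Summit.BirchSwinnertonDyer.Rank1Residual.X11a

namespace MuCoset

variable (p : ℕ) [Fact p.Prime]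

/-- **Every unit `u` modulo `p^{n+1}` (odd `p`) has `u^{p−1} = (1+p)^{(p−1)s₀}` for some exponent
`s₀ mod pⁿ`**: `u = ξ·γ^{s₀}` with `ξ` a Teichmüller representative (`exists_classMap_eq`), `ξ^{p−1} = 1`,
`γ = 1 + p`. So the records' coset description `b^{p−1} = u^{p−1}` is the door's `b^{p−1} = (1+p)^{(p−1)s₀}`.
[cite: Washington1997, §5.1 and §7.2] -/
theorem exists_pow_sub_one_eq_cyclotomicGenerator_pow (hp2 : p ≠ 2) (n : ℕ) (u : ZMod (p ^ (n + 1)))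
    (hu : IsUnit u) :
    ∃ s₀ : ZMod (p ^ n), u ^ (p - 1) = ((1 + p : ℕ) : ZMod (p ^ (n + 1))) ^ ((p - 1) * s₀.val) := by
  have he : cyclotomicExponent p = 1 := if_neg hp2
  have hγ : cyclotomicGenerator p = 1 + p := by rw [cyclotomicGenerator, he, pow_one]
  have hτ : torsionOrder p = p - 1 := by rw [torsionOrder_eq, if_neg hp2]
  -- transport `u` to the tree's level `n + cyclotomicExponent p`
  have key : ∀ (e : ℕ), cyclotomicExponent p = e → ∀ (v : ZMod (p ^ (n + e))), IsUnit v →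
      ∃ s₀ : ZMod (p ^ n), v ^ torsionOrder p =
        (cyclotomicGenerator p : ZMod (p ^ (n + e))) ^ (torsionOrder p * s₀.val) := by
    intro e hee v hv
    subst hee
    obtain ⟨ξ, s, hξs⟩ := exists_classMap_eq p n hv.unit
    rw [IsUnit.unit_spec] at hξs
    refine ⟨s, ?_⟩
    rw [← hξs, mul_pow, ← map_pow, rootsOfUnity_pow_torsionOrder, map_one, one_mul, ← pow_mul, mul_comm]
  obtain ⟨s₀, hs₀⟩ := key 1 he u hu
  refine ⟨s₀, ?_⟩
  rw [hτ, hγ] at hs₀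
  exact hs₀

end MuCoset

section Door

variable {W : WeierstrassCurve ℚ} [W.IsElliptic] [W.IsGloballyMinimal] {p : ℕ} [Fact p.Prime]

/-- **THE TEICHMÜLLER-COSET `μ`-CERTIFICATE, representative form** (`u` displayed, `p ∤ u`; the coset is
`{b : b^{p−1} = u^{p−1}}` exactly as in ty3's `Record.checkMu`): same conclusion `X11a.MuAnZeroAt W p` and
same displayed data as `muAnZeroAt_of_cosetTable` (special value `t`, table `xs` on `S`, unit sum), modulo
Mazur 1978 Cor. 4.1. [cite: MazurTateTeitelbaum1986Invent, §I.10 and §I.12–I.13] [cite: Mazur1978, Cor. 4.1] -/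
theorem muAnZeroAt_of_cosetTable_of_unitRep (hMz : mazur_not_dvd_maninConstant_of_odd) (hp2 : p ≠ 2)
    (hmult : W.HasMultiplicativeReductionAtPrime p) (hirr : W.HasIrreducibleModPGaloisRep p)
    (t : ℚ) (ht : W.entireLFunction 1 / (W.realPeriodRat : ℂ) = (t : ℂ))
    (htint : ‖((t : ℚ) : ℚ_[p])‖ ≤ 1) (n : ℕ) (u : ZMod (p ^ (n + 1))) (hu : IsUnit u)
    (S : Finset (ZMod (p ^ (n + 1)))) (hS : ∀ b : ZMod (p ^ (n + 1)), b ∈ S ↔ b ^ (p - 1) = u ^ (p - 1))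
    (xs : ZMod (p ^ (n + 1)) → ℚ)
    (hxs : ∀ {N : ℕ} [NeZero N] (f : CuspForm (Gamma0 N) 2), IsNewformOf W f →
      ∀ (ϖ : ℚ), (ϖ : ℝ) * W.realPeriodRat = plusPeriod f →
        ∀ b ∈ S, ϖ * ratPlusSymbol f ((b.val : ℚ) / (p : ℚ) ^ (n + 1)) = xs b)
    (hunit : ‖((∑ b ∈ S, xs b : ℚ) : ℚ_[p])‖ = 1) :
    X11a.MuAnZeroAt W p := by
  obtain ⟨s₀, hs₀⟩ := MuCoset.exists_pow_sub_one_eq_cyclotomicGenerator_pow p hp2 n u hu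
  exact muAnZeroAt_of_cosetTable hMz hp2 hmult hirr t ht htint n s₀ S
    (fun b ↦ by rw [hS b, hs₀]) xs hxs hunit

variable (W p)

/-- **PER-PAIR DOOR, class-free, representative form**: `Typed.MissingUpperBoundAt W p` at an odd
multiplicative prime with `E[p]` irreducible, `ρ̄_{E,p}` not onto, `r_an = 0`, from the coset table on
`{b : b^{p−1} = u^{p−1}}` — the ten facts + Greenberg–Stevens + Mazur. [cite: Kato2004Asterisque, Thm. 12.4 (p. 221), §17.13 (pp. 279–280)]
[cite: Wuthrich2014, Cor. 18 (p. 398)] [cite: SteinWuthrich2013, Thm. 6.1 (p. 20)] [cite: Mazur1978, Cor. 4.1] -/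
theorem missingUpperBoundAt_of_cosetTable_of_unitRep
    (hJs : thm61_splitMultiplicative) (hJn : thm61_nonsplitMultiplicative)
    (hGZK : rank_eq_analyticRank_of_analyticRank_le_one) (hpar : nonempty_modularParametrizationData)
    (h12 : Kato2004.thm12_4) (hns : Kato2004.exists_multDivisibilityInputs_nonsplit)
    (hsp : Kato2004.exists_multDivisibilityInputs_split) (h15 : thm15_isTorsion_multiplicative_rat)
    (h18 : Wuthrich2014.corollary18_padicLFunction_mem_iwasawaAlgebra_multiplicative)
    (hfine : Kato2004.exists_multDivisibilityInputs_fine)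
    (hGS : greenberg_stevens (W := W) (p := p)) (hMz : mazur_not_dvd_maninConstant_of_odd)
    (hp2 : p ≠ 2) (hr : W.analyticRank = 0) (hmult : W.HasMultiplicativeReductionAtPrime p)
    (hirr : W.HasIrreducibleModPGaloisRep p) (hnsj : ¬ Surj W p)
    (t : ℚ) (ht : W.entireLFunction 1 / (W.realPeriodRat : ℂ) = (t : ℂ))
    (htint : ‖((t : ℚ) : ℚ_[p])‖ ≤ 1) (n : ℕ) (u : ZMod (p ^ (n + 1))) (hu : IsUnit u)
    (S : Finset (ZMod (p ^ (n + 1)))) (hS : ∀ b : ZMod (p ^ (n + 1)), b ∈ S ↔ b ^ (p - 1) = u ^ (p - 1))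
    (xs : ZMod (p ^ (n + 1)) → ℚ)
    (hxs : ∀ {N : ℕ} [NeZero N] (f : CuspForm (Gamma0 N) 2), IsNewformOf W f →
      ∀ (ϖ : ℚ), (ϖ : ℝ) * W.realPeriodRat = plusPeriod f →
        ∀ b ∈ S, ϖ * ratPlusSymbol f ((b.val : ℚ) / (p : ℚ) ^ (n + 1)) = xs b)
    (hunit : ‖((∑ b ∈ S, xs b : ℚ) : ℚ_[p])‖ = 1) : MissingUpperBoundAt W p :=
  missingUpperBoundAt_of_muAnZeroAt_of_analyticRank_eq_zero W p hJs hJn hGZK hpar h12 hns hsp h15 h18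
    hfine hGS hp2 hr hmult hirr hnsj
    (muAnZeroAt_of_cosetTable_of_unitRep hMz hp2 hmult hirr t ht htint n u hu S hS xs hxs hunit)

/-- **PER-PAIR DOOR, class-free, representative form, NON-SPLIT** (no Greenberg–Stevens binder).
[cite: Kato2004Asterisque, §17.13 (pp. 279–280)] [cite: Wuthrich2014, Cor. 18 (p. 398)] [cite: Mazur1978, Cor. 4.1] -/
theorem missingUpperBoundAt_of_cosetTable_of_unitRep_of_nonsplit
    (hJs : thm61_splitMultiplicative) (hJn : thm61_nonsplitMultiplicative)
    (hGZK : rank_eq_analyticRank_of_analyticRank_le_one) (hpar : nonempty_modularParametrizationData)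
    (h12 : Kato2004.thm12_4) (hns : Kato2004.exists_multDivisibilityInputs_nonsplit)
    (hsp : Kato2004.exists_multDivisibilityInputs_split) (h15 : thm15_isTorsion_multiplicative_rat)
    (h18 : Wuthrich2014.corollary18_padicLFunction_mem_iwasawaAlgebra_multiplicative)
    (hfine : Kato2004.exists_multDivisibilityInputs_fine) (hMz : mazur_not_dvd_maninConstant_of_odd)
    (hp2 : p ≠ 2) (hr : W.analyticRank = 0) (hmult : W.HasMultiplicativeReductionAtPrime p)
    (hirr : W.HasIrreducibleModPGaloisRep p) (hnsj : ¬ Surj W p)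
    (hnsp : ¬ W.HasSplitMultiplicativeReductionAtPrime p)
    (t : ℚ) (ht : W.entireLFunction 1 / (W.realPeriodRat : ℂ) = (t : ℂ))
    (htint : ‖((t : ℚ) : ℚ_[p])‖ ≤ 1) (n : ℕ) (u : ZMod (p ^ (n + 1))) (hu : IsUnit u)
    (S : Finset (ZMod (p ^ (n + 1)))) (hS : ∀ b : ZMod (p ^ (n + 1)), b ∈ S ↔ b ^ (p - 1) = u ^ (p - 1))
    (xs : ZMod (p ^ (n + 1)) → ℚ)
    (hxs : ∀ {N : ℕ} [NeZero N] (f : CuspForm (Gamma0 N) 2), IsNewformOf W f →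
      ∀ (ϖ : ℚ), (ϖ : ℝ) * W.realPeriodRat = plusPeriod f →
        ∀ b ∈ S, ϖ * ratPlusSymbol f ((b.val : ℚ) / (p : ℚ) ^ (n + 1)) = xs b)
    (hunit : ‖((∑ b ∈ S, xs b : ℚ) : ℚ_[p])‖ = 1) : MissingUpperBoundAt W p :=
  missingUpperBoundAt_of_muAnZeroAt_of_analyticRank_eq_zero_of_nonsplit W p hJs hJn hGZK hpar h12 hns hsp
    h15 h18 hfine hp2 hr hmult hirr hnsj hnsp
    (muAnZeroAt_of_cosetTable_of_unitRep hMz hp2 hmult hirr t ht htint n u hu S hS xs hxs hunit)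

end Door

end Summit.BirchSwinnertonDyer.Rank1Residual.X11a

end
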